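import Summits.ResolutionOfSingularities.ResolutionOfSingularities.Theorems.WildPurityWildSymbolSandwich
import Literature.AlgebraicGeometry.Resolution.InseparableLocalUniformization
import Literature.AlgebraicGeometry.Resolution.DivisorialPlace
import Literature.NumberTheory.GaloisCohomology.KatoCohomologyPurity
import HarnessLib

/-!
# `WildSymbol` (stmt-ResolutionOfSingularities-17133), line `birth` — modulo Temkin's inseparable local
# uniformization the crux IS the failure of sandwich purity: `Temkin2013Relative → (WildSymbol ↔ ¬ SP)`

Support file for crux #2 of route `ResolutionOfSingularities/WildPurity`
(`Summit.ResolutionOfSingularities.ResolutionOfSingularities.Theses.WildPurity.WildSymbol`), line `birth`.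
Companion of `Theorems/WildPurityWildSymbolSandwich.lean` (where "sandwich purity" SP is explained and written
out inline, and `¬ SP → WildSymbol` is proved unconditionally) and of
`Theorems/WildPurityWildSymbolFrobeniusBlind.lean` (the test class of (D) is blind to `p`-radical enlargement).

## What is proved

* `sandwich_of_temkin2013Relative` — **Step A+B of the sandwich reduction, kernel-checked.** Assume the named
  fact `Literature.AlgebraicGeometry.Resolution.Temkin2013Relative` (Temkin, arXiv:0804.1554, Thm. 1.2, the
  corrected relative rendering of the tree). For every crux datum `(p, k, K, O, R)` there are a finitely
  generated `B ⊆ O` and an exponent `e` such that `K` is `p`-radical over `Frac B` (`x^{p^e}·s = y`), the local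
  ring of the point `locAt B O` is REGULAR, and every `r ∈ R` has `r^{p^e} ∈ B`. Construction (Temkin's Remark
  1.5 (i), made explicit): (T) gives `L/K` finite purely inseparable, `R ⊆ A' ⊆ O`, the `L`-normalisation `N` of
  `A'` (finitely generated, `Frac N = L`), the valuation ring `O'` of `L` over `O` and the REGULAR local ring
  `N_𝔭`, `𝔭 = 𝔪_{O'} ∩ N`; with `e :=` the exponent of `L/K` and `φ := IsPurelyInseparable.iterateFrobenius :
  L →+* K` (`φ x = x^{p^e}` read in `K`), put `B := φ(N)` (`= k[φ(generators)]`, as `φ(k) = k` for perfect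
  `k`); then `B ⊆ O`, `K^{p^e} ⊆ φ(L) = Frac B`, `R^{p^e} = φ(R) ⊆ φ(N) = B` (`R ⊆ A' ⊆ N`), and
  `locAt B O = φ(N_𝔭)` (centres correspond because `𝔪_O`, `𝔪_{O'}` are root-closed), which is regular by
  transport along `Localization.AtPrime 𝔭 ≃ N_𝔭 ⊆ L ≃ φ(N_𝔭)`.
* `not_wildSymbol_of_temkin2013Relative_of_sandwichPurity` — `Temkin2013Relative → SP → ¬ WildSymbol`:
  (D) for `R` passes to (D) for `B` by `divIntegral_iff_of_pRadical` (every element of `R` is `p`-radical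
  over `B`), SP gives `α ∈ Unr(O)`, contradicting (N).
* `wildSymbol_iff_not_sandwichPurity_of_temkin2013Relative` — with `wildSymbol_of_not_sandwichPurity`:
  **given Temkin 2013, `WildSymbol ↔ ¬ SP`.** The crux (a certified failure of valuative purity for `H³_p`) is
  EXACTLY a failure of purity over a Frobenius sandwich of a regular germ; `¬ WildSymbol` is exactly SP.

`Temkin2013Relative` is an unproved named fact of the tree (its discharge is the business of the `Temkin2013`
unit: `Temkin2013Relative.of_smoothFibre`); every theorem here takes it as an explicit hypothesis, so nothing is
asserted unconditionally except the elementary directions. No definition is declared.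
-/

noncomputable section

-- single-problem summit: the doubled namespace component `ResolutionOfSingularities` is forced
set_option linter.dupNamespace false

namespace Summit.ResolutionOfSingularities.ResolutionOfSingularities.Theorems.WildSymbol.Birth

open Summit.ResolutionOfSingularities.ResolutionOfSingularities.Theses.WildPurity (WildSymbol)
open Literature.AlgebraicGeometry.Resolution (Temkin2013Relative centreIdeal
  mem_centreIdeal_iff_coe_mem_nonunits)
open Literature.NumberTheory.GaloisCohomology (localizationIn mem_localizationIn_iff)

/-- **The sandwich supplied by Temkin's theorem (Remark 1.5 (i) made explicit).** Assuming
`Temkin2013Relative`: for `K/k` finitely generated over the perfect field `k` of characteristic `p`, a valuation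
ring `O ⊇ k` of `K` and an affine model `R ⊆ O` (`Frac R = K`), there are a finitely generated `B ⊆ O` and
`e : ℕ` with: every `x ∈ K` satisfies `x^{p^e}·s = y` for some `y, s ∈ B`, `s ≠ 0`; the local ring
`locAt B O` is a regular local ring; and `r^{p^e} ∈ B` for every `r ∈ R`. (`B` is the image of the regular
uniformizing chart `Nr_L(X')` under the `p^e`-th power map `L → K`.) [cite: Temkin2013, Thm. 1.3.2 and Remark 1.5 (i) (arXiv:0804.1554v3)] -/
theorem sandwich_of_temkin2013Relative (hT : Temkin2013Relative.{0}) {p : ℕ} (hp : p.Prime) (k K : Type)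
    [Field k] [CharP k p] [PerfectField k] [Field K] [Algebra k K] (hfg : (⊤ : IntermediateField k K).FG)
    (O : ValuationSubring K) (hO : ∀ c : k, algebraMap k K c ∈ O) (R : Subalgebra k K) (hR : R.FG)
    (hRO : R.toSubring ≤ O.toSubring) (hfr : IsFractionRing R K) :
    ∃ (B : Subalgebra k K) (e : ℕ), B.FG ∧ B.toSubring ≤ O.toSubring ∧
      (∀ x : K, ∃ y s : K, y ∈ B ∧ s ∈ B ∧ s ≠ 0 ∧ x ^ (p ^ e) * s = y) ∧
      IsRegularLocalRing (locAt (B : Set K) O) ∧ ∀ r : K, r ∈ R → r ^ (p ^ e) ∈ B := by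
  classical
  obtain ⟨L, iFL, iAKL, iAkL, iST, hfin, hpi, l, -, -, A', hRA', hA'O, -, -, O', hO'O, N, hN, hNint, hNfg,
    hNfr, -, -, hreg⟩ := hT k K hfg O hO R hRO hR hfr
  haveI : Fact p.Prime := ⟨hp⟩
  haveI : CharP K p := charP_of_injective_algebraMap (algebraMap k K).injective p
  haveI : ExpChar K p := ExpChar.prime hp
  haveI : ExpChar k p := ExpChar.prime hp
  haveI : IsPurelyInseparable K L := hpi
  haveI : FiniteDimensional K L := hfin
  haveI : IsFractionRing N L := hNfr
  -- the exponent of `L/K` and the `p^e`-th power map `φ : L → K`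
  set e : ℕ := IsPurelyInseparable.exponent K L with he
  let φ : L →+* K := IsPurelyInseparable.iterateFrobenius K L p (le_refl e)
  have hφ : ∀ a : L, algebraMap K L (φ a) = a ^ p ^ e := fun a =>
    IsPurelyInseparable.algebraMap_iterateFrobenius K p (le_refl e) a
  have hφK : ∀ x : K, φ (algebraMap K L x) = x ^ p ^ e := fun x =>
    IsPurelyInseparable.iterateFrobenius_algebraMap (K := K) (L := L) (p := p) (le_refl e) x
  have hφinj : Function.Injective φ := φ.injective
  -- membership in `O` / `𝔪_O` read upstairs
  have hmemO : ∀ x : K, x ∈ O ↔ algebraMap K L x ∈ O' := fun x => by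
    rw [← hO'O]; exact ValuationSubring.mem_comap
  have hnonu : ∀ x : K, x ∈ O.nonunits ↔ algebraMap K L x ∈ O'.nonunits := fun x => by
    rw [ValuationSubring.mem_nonunits_iff_or, ValuationSubring.mem_nonunits_iff_or, ← map_inv₀,
      hmemO, map_eq_zero]
  have hφO : ∀ a : L, a ∈ O' → φ a ∈ O := fun a ha => by
    rw [hmemO, hφ]; exact O'.pow_mem ha _
  have hφnonu : ∀ a : L, φ a ∈ O.nonunits ↔ a ∈ O'.nonunits := fun a => by
    rw [hnonu, hφ]
    exact ⟨fun h => mem_nonunits_of_pow_mem_nonunits O' (pow_ne_zero e hp.ne_zero) h,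
      fun h => pow_mem_nonunits O' (pow_ne_zero e hp.ne_zero) h⟩
  -- `B := φ(N)`, finitely generated over `k` by the images of generators of `N`
  obtain ⟨t, ht⟩ := hNfg
  let B : Subalgebra k K := Algebra.adjoin k ((t.image φ : Finset K) : Set K)
  have hBfg : B.FG := Subalgebra.fg_adjoin_finset _
  -- every element of `N` maps into `B`
  have hNB : ∀ n : L, n ∈ N → φ n ∈ B := by
    intro n hn
    have hn' : n ∈ Algebra.adjoin k (t : Set L) := by
      rw [ht]; exact hn
    refine Algebra.adjoin_induction (fun x hx => ?_) (fun c => ?_) (fun x y _ _ hx hy => ?_)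
      (fun x y _ _ hx hy => ?_) hn'
    · exact Algebra.subset_adjoin (by simpa using Finset.mem_image_of_mem φ hx)
    · rw [IsScalarTower.algebraMap_apply k K L, hφK, ← map_pow]
      exact B.algebraMap_mem _
    · rw [map_add]; exact B.add_mem hx hy
    · rw [map_mul]; exact B.mul_mem hx hy
  -- and `B ⊆ φ(N)`: `φ(N)` is a `k`-subalgebra (it contains `k = k^{p^e}`, `k` being perfect)
  let BN : Subalgebra k K :=
    { N.toSubring.map φ with
      algebraMap_mem' := fun c => by
        refine ⟨algebraMap k L ((iterateFrobeniusEquiv k p e).symm c), ?_, ?_⟩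
        · exact (N.restrictScalars k).algebraMap_mem _
        · show φ (algebraMap k L _) = algebraMap k K c
          rw [IsScalarTower.algebraMap_apply k K L, hφK, ← map_pow, ← iterateFrobeniusEquiv_def,
            RingEquiv.apply_symm_apply] }
  have hBN : B ≤ BN := by
    refine Algebra.adjoin_le ?_
    intro x hx
    obtain ⟨n, hn, rfl⟩ := Finset.mem_image.mp (Finset.mem_coe.mp hx)
    have hnN : n ∈ N := by
      have : n ∈ Algebra.adjoin k (t : Set L) := Algebra.subset_adjoin hn
      rw [ht] at this; exact this
    exact ⟨n, hnN, rfl⟩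
  have hmemB : ∀ x : K, x ∈ B ↔ ∃ n : L, n ∈ N ∧ φ n = x := fun x =>
    ⟨fun hx => let ⟨n, hn, hnx⟩ := hBN hx; ⟨n, hn, hnx⟩, fun ⟨n, hn, hnx⟩ => hnx ▸ hNB n hn⟩
  -- `B ⊆ O`
  have hBO : B.toSubring ≤ O.toSubring := by
    intro x hx
    obtain ⟨n, hn, rfl⟩ := (hmemB x).mp hx
    exact hφO n (hN hn)
  -- `K` is `p`-radical over `Frac B = φ(L)`
  have hrad : ∀ x : K, ∃ y s : K, y ∈ B ∧ s ∈ B ∧ s ≠ 0 ∧ x ^ (p ^ e) * s = y := by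
    intro x
    obtain ⟨a, b, hb, hab⟩ := IsFractionRing.div_surjective (A := N) (algebraMap K L x)
    have hb0 : (b : L) ≠ 0 := by
      have := nonZeroDivisors.ne_zero hb
      exact fun h => this (Subtype.ext h)
    refine ⟨φ a, φ b, hNB _ a.2, hNB _ b.2, (map_ne_zero φ).mpr hb0, ?_⟩
    rw [← hφK x, ← map_mul, ← hab]
    congr 1
    show (a : L) / b * b = a
    rw [div_mul_cancel₀ _ hb0]
  -- `R^{p^e} ⊆ B`: `R ⊆ A' ⊆ N` (elements of `A'` are integral over `A'`)
  have hRN : ∀ r : K, r ∈ R → algebraMap K L r ∈ N := by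
    intro r hr
    have hmem : algebraMap K L r ∈ A'.map (IsScalarTower.toAlgHom k K L) :=
      Subalgebra.mem_map.mpr ⟨r, hRA' hr, rfl⟩
    have : algebraMap K L r ∈ (N : Set L) := by
      rw [hNint]
      exact isIntegral_algebraMap (R := A'.map (IsScalarTower.toAlgHom k K L)) (x := ⟨_, hmem⟩)
    exact this
  have hRB : ∀ r : K, r ∈ R → r ^ (p ^ e) ∈ B := fun r hr => by
    rw [← hφK]; exact hNB _ (hRN r hr)
  -- `locAt B O = φ(N_𝔭)` is regular
  let 𝔭 : Ideal N := centreIdeal N O' hN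
  haveI : IsRegularLocalRing (Localization.AtPrime 𝔭) := hreg
  have hreg1 : IsRegularLocalRing (localizationIn L 𝔭) :=
    IsRegularLocalRing.of_ringEquiv (R := Localization.AtPrime 𝔭)
      (Localization.algEquiv 𝔭.primeCompl (localizationIn L 𝔭)).toRingEquiv
  have hS : (localizationIn L 𝔭).toSubring.map φ = locAt (B : Set K) O := by
    ext x
    constructor
    · rintro ⟨w, hw, rfl⟩
      obtain ⟨a, s, hs, hws⟩ := (mem_localizationIn_iff 𝔭 w).mp hw
      refine (mem_locAt_iff B O (φ w)).mpr ⟨φ a, φ s, hNB _ a.2, hNB _ s.2, ?_, ?_⟩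
      · rw [hφnonu]
        exact fun h => hs ((mem_centreIdeal_iff_coe_mem_nonunits N O' hN s).mpr h)
      · rw [← map_mul]
        exact congrArg φ hws
    · intro hx
      obtain ⟨r, s, hr, hsB, hsO, hxs⟩ := (mem_locAt_iff B O x).mp hx
      obtain ⟨a, ha, rfl⟩ := (hmemB r).mp hr
      obtain ⟨b, hbN, rfl⟩ := (hmemB s).mp hsB
      have hb𝔭 : (⟨b, hbN⟩ : N) ∉ 𝔭 := fun h =>
        hsO ((hφnonu b).mpr ((mem_centreIdeal_iff_coe_mem_nonunits N O' hN ⟨b, hbN⟩).mp h))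
      have hb0 : b ≠ 0 := by
        rintro rfl
        exact ne_zero_of_not_mem_nonunits O hsO (map_zero φ)
      refine ⟨a / b, (mem_localizationIn_iff 𝔭 _).mpr ⟨⟨a, ha⟩, ⟨b, hbN⟩, hb𝔭, ?_⟩, ?_⟩
      · show a / b * b = a
        rw [div_mul_cancel₀ _ hb0]
      · show φ (a / b) = x
        have hφb : φ b ≠ 0 := (map_ne_zero φ).mpr hb0
        rw [map_div₀, div_eq_iff hφb, hxs]
  have hreg2 : IsRegularLocalRing (locAt (B : Set K) O) := by
    rw [← hS]
    haveI := hreg1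
    exact IsRegularLocalRing.of_ringEquiv
      ((localizationIn L 𝔭).toSubring.equivMapOfInjective φ hφinj)
  exact ⟨B, e, hBfg, hBO, hrad, hreg2, hRB⟩

/-- **`Temkin2013Relative → SP → ¬ WildSymbol`**: given Temkin's inseparable local uniformization, sandwich
purity (the statement of `Theorems/WildPurityWildSymbolSandwich.lean`, inline) refutes the crux. Proof: a
witness `(p, k, K, O, R, α)`; the sandwich `(B, e)` of `sandwich_of_temkin2013Relative`; (D) for `R` is (D)
for `B ⊔ R` (enlarging the model is free) which is (D) for `B` (`divIntegral_iff_of_pRadical`, every element of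
`R` having its `p^e`-th power in `B ⊆ locAt B O`); SP at `(B, e)` gives `α ∈ Unr(O)`, contradicting (N).
[cite: Temkin2013, Thm. 1.3.2 and Remark 1.5 (i) (arXiv:0804.1554v3)] -/
theorem not_wildSymbol_of_temkin2013Relative_of_sandwichPurity (hT : Temkin2013Relative.{0})
    (hSP : ∀ p : ℕ, p.Prime → ∀ (k K : Type) [Field k] [CharP k p] [PerfectField k] [Field K] [Algebra k K],
      (⊤ : IntermediateField k K).FG → ∀ O : ValuationSubring K, (∀ c : k, algebraMap k K c ∈ O) →
      ∀ B : Subalgebra k K, B.FG → B.toSubring ≤ O.toSubring →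
      (∃ e : ℕ, ∀ x : K, ∃ y s : K, y ∈ B ∧ s ∈ B ∧ s ≠ 0 ∧ x ^ (p ^ e) * s = y) →
      IsRegularLocalRing (locAt (B : Set K) O) →
      ∀ α : G K ⧸ N p K, DivIntegral p k K B O α → α ∈ Unr p K O.toSubring) :
    ¬ WildSymbol := by
  intro hW
  obtain ⟨p, hp, k, K, ik, icp, ipf, iK, ialg, hfg, O, hO, R, hR, hRO, hfr, α, hdiv, hα⟩ :=
    (wildSymbol_iff).mp hW
  haveI : Fact p.Prime := ⟨hp⟩
  haveI : CharP K p := charP_of_injective_algebraMap (algebraMap k K).injective p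
  obtain ⟨B, e, hBfg, hBO, hrad, hreg, hRB⟩ :=
    sandwich_of_temkin2013Relative hT hp k K hfg O hO R hR hRO hfr
  -- (D) for `R` ⇒ (D) for `B ⊔ R` (fewer tests) ⇒ (D) for `B` (Frobenius blindness)
  have hdiv' : DivIntegral p k K (B ⊔ Algebra.adjoin k (R : Set K)) O α := by
    intro W hk hdvr heft hle hcen
    have hRle : R ≤ B ⊔ Algebra.adjoin k (R : Set K) := by
      rw [Algebra.adjoin_eq]; exact le_sup_right
    exact hdiv W hk hdvr heft (fun x hx => hle (hRle hx)) (fun x hx hxW => hcen x (hRle hx) hxW)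
  have hdivB : DivIntegral p k K B O α :=
    (divIntegral_iff_of_pRadical p B O α (R : Set K) e
      (fun y hy => le_locAt B O (hRB y hy))).mpr hdiv'
  exact hα (hSP p hp k K hfg O hO B hBfg hBO ⟨e, hrad⟩ hreg α hdivB)

/-- **Given Temkin 2013, the crux `WildSymbol` is EQUIVALENT to the failure of sandwich purity**
(`wildSymbol_of_not_sandwichPurity` for `←`, `not_wildSymbol_of_temkin2013Relative_of_sandwichPurity` for
`→`): a certified failure of valuative purity for `H³_p` exists iff one exists over a Frobenius sandwich of a
REGULAR germ (a `p`-radical enlargement of a regular local ring essentially of finite type over `k`).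
[cite: Temkin2013, Thm. 1.3.2 and Remark 1.5 (i)–(iii) (arXiv:0804.1554v3)] -/
theorem wildSymbol_iff_not_sandwichPurity_of_temkin2013Relative (hT : Temkin2013Relative.{0}) :
    WildSymbol ↔ ¬ ∀ p : ℕ, p.Prime → ∀ (k K : Type) [Field k] [CharP k p] [PerfectField k] [Field K] [Algebra k K],
      (⊤ : IntermediateField k K).FG → ∀ O : ValuationSubring K, (∀ c : k, algebraMap k K c ∈ O) →
      ∀ B : Subalgebra k K, B.FG → B.toSubring ≤ O.toSubring →
      (∃ e : ℕ, ∀ x : K, ∃ y s : K, y ∈ B ∧ s ∈ B ∧ s ≠ 0 ∧ x ^ (p ^ e) * s = y) →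
      IsRegularLocalRing (locAt (B : Set K) O) →
      ∀ α : G K ⧸ N p K, DivIntegral p k K B O α → α ∈ Unr p K O.toSubring :=
  ⟨fun hW hSP => not_wildSymbol_of_temkin2013Relative_of_sandwichPurity hT hSP hW,
    wildSymbol_of_not_sandwichPurity⟩

end Summit.ResolutionOfSingularities.ResolutionOfSingularities.Theorems.WildSymbol.Birth

end
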